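import Literature.MathematicalPhysics.QuantumFieldTheory.BalabanImbrieJaffe1984to88.BIJ88ChiTDeriv309

/-!
# `BalabanImbrieJaffe1984to88.BIJ88RestrictionsVanish308` — T. Bałaban, J. Imbrie, A. Jaffe, *Effective action and cluster properties of
the abelian Higgs model*, Commun. Math. Phys. **114** (1988) 257–315 [BalabanImbrieJaffe1988]: Sect. 5.14, p. 308 [PDF 52], the
interpolation in `t`, verbatim: *"Define z_t(Λ₁₂^{(k)}) for t ∈ [0, 1] by replacing Ṽ(Λ₁₂^{(k)}) with tṼ(Λ₁₂^{(k)}), replacing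
χ(cp(e_k), (I − Q^{s*}Q)A^{(k)}) with χ(cp(te_k), (I − Q^{s*}Q)A^{(k)}), and similarly for χ(cp(e_k), φ^{(k)}). Thus the restrictions
and the interactions disappear at t = 0, at which point we have a purely Gaussian expectation."*

PROVED, on r16's cutoff (5.2.3)/(5.2.4) `BIJ88Sect5Statements.CutoffProfile`/`cutoff` and r18's logarithmic scale (2.33)
`BIJ88Sect2Statements.pLog`, the clause *"the restrictions … disappear at t = 0"*: for every fixed field value `A` and constants
`c > 0`, `p > 0`, `e_k > 0`, the interpolated χ-factor `χ(c·p(te_k), A)` EQUALS 1 for all small `t` — quantitatively for `0 < t` and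
`t·e_k ≤ exp(−(|A|/((9/10)c))^{1/p})` (`cutoff_t_eq_one_of_le`: the radius `c·p(te_k) = c·|log(te_k)|^p` exceeds `(10/9)|A|`, and
χ(1,·) = 1 on |x| ≤ 9/10) — hence it is eventually 1 and tends to 1 as `t → 0⁺` (`eventually_cutoff_t_eq_one`, `tendsto_cutoff_t_one`);
and the clause *"the interactions disappear"*: the interpolated Boltzmann factor `e^{−tṼ}` is 1 at `t = 0` and tends to 1
(`exp_interaction_zero`, `tendsto_exp_interaction_one`).  NOTE (scope): the statement is pointwise in `A` — for fixed `t > 0` the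
factor still cuts off large `|A|`; no uniformity in `A` is claimed or printed.

statement-level skeleton of published theorems with citation tags; proofs where landed; nothing here is a claim about the Yang–Mills mass gap

PDF held: `paper:balaban1988-cmp114-bij-abelian-higgs-effective-action` (journal page = PDF page + 256).  Page read as image: PDF p. 52
(journal 308), `g4png.py` ×2 render (seat folder `renders/original-p052-x2.png`).

CITATION HEADER (lean-in-tree rule).  Part of the lit-balaban TYPED SKELETON (HOME `run/shared/lean/pub/lit-balaban/`), Phase 2,
seat p36 (gen 5, unit `lit-balaban-p36`); row **C2.Eq5.14.1-5.14.2** of `HOME/lit-balaban-r16/ROWS-C2-part2.md` (typed p245624: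
(5.14.2) `pertP`/`remR` + Taylor; the interpolation sentence between (5.14.1) and (5.14.2) is the member proved here).  Companion of
`BIJ88ChiTDeriv309` / `BIJ88ChiTDerivN309` (the t-derivatives of the same factor).  Theorems only; no definitions, no `Prop` facts;
axioms standard.
-/

namespace Literature.MathematicalPhysics.QuantumFieldTheory.BalabanImbrieJaffe1984to88.BIJ88RestrictionsVanish308

open BIJ88Sect2Statements (pLog)
open BIJ88Sect5Statements (CutoffProfile cutoff cutoff_eq_one)
open Filter Topology

/-! ## The restrictions disappear at t = 0 -/

/-- (2.33) is non-negative: `p(x) = |log x⁻¹|^p ≥ 0`. [cite: BalabanImbrieJaffe1988, (2.33) p.263] -/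
theorem pLog_nonneg (p x : ℝ) : 0 ≤ pLog p x :=
  Real.rpow_nonneg (abs_nonneg _) p

/-- The radius grows without bound as `t → 0⁺`: for `0 < t`, `0 < e_k`, `p > 0`, `M ≥ 0` and `t·e_k ≤ exp(−M^{1/p})` one has
`p(te_k) = |log(te_k)⁻¹|^p ≥ M`. [cite: BalabanImbrieJaffe1988, (2.33) p.263] -/
theorem le_pLog_of_le {p M t ek : ℝ} (hp : 0 < p) (hM : 0 ≤ M) (ht : 0 < t) (hek : 0 < ek)
    (h : t * ek ≤ Real.exp (-(M ^ p⁻¹))) : M ≤ pLog p (t * ek) := by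
  have htek : 0 < t * ek := mul_pos ht hek
  have hlog : M ^ p⁻¹ ≤ -Real.log (t * ek) := by
    have := Real.log_le_log htek h
    rw [Real.log_exp] at this
    linarith
  have habs : M ^ p⁻¹ ≤ |Real.log (t * ek)⁻¹| := by
    rw [Real.log_inv]
    exact hlog.trans (le_abs_self _)
  unfold pLog
  calc M = (M ^ p⁻¹) ^ p := (Real.rpow_inv_rpow hM hp.ne').symm
    _ ≤ |Real.log (t * ek)⁻¹| ^ p := Real.rpow_le_rpow (Real.rpow_nonneg hM _) habs hp.le

/-- **p. 308, "the restrictions … disappear at t = 0", quantitatively**: for `c > 0`, `p > 0`, `e_k > 0`, every real `A` and every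
`0 < t` with `t·e_k ≤ exp(−(|A|/((9/10)c))^{1/p})`, the interpolated χ-factor is `χ(c·p(te_k), A) = 1`.
[cite: BalabanImbrieJaffe1988, (5.14.2) p.308] -/
theorem cutoff_t_eq_one_of_le (χ : CutoffProfile) {c p ek t : ℝ} (hc : 0 < c) (hp : 0 < p) (hek : 0 < ek) (ht : 0 < t) (A : ℝ)
    (h : t * ek ≤ Real.exp (-((|A| / (9 / 10 * c)) ^ p⁻¹))) : cutoff χ (c * pLog p (t * ek)) A = 1 := by
  have hM : 0 ≤ |A| / (9 / 10 * c) := div_nonneg (abs_nonneg A) (by positivity)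
  have hle : |A| / (9 / 10 * c) ≤ pLog p (t * ek) := le_pLog_of_le hp hM ht hek h
  have hA : |A| ≤ 9 / 10 * (c * pLog p (t * ek)) := by
    rw [div_le_iff₀ (by positivity)] at hle
    linarith
  by_cases hq : pLog p (t * ek) = 0
  · -- degenerate radius: then |A| = 0 and χ(1, 0/0) = χ(1, 0) = 1
    have hA0 : A = 0 := by
      rw [hq, mul_zero, mul_zero] at hA
      exact abs_eq_zero.mp (le_antisymm hA (abs_nonneg A))
    simp only [cutoff, hA0, zero_div]
    exact χ.eq_one 0 (by norm_num)
  · have hq0 : 0 < c * pLog p (t * ek) := mul_pos hc (lt_of_le_of_ne (pLog_nonneg p _) (Ne.symm hq))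
    exact cutoff_eq_one χ hq0 hA

/-- **p. 308, "the restrictions … disappear at t = 0"**: for `c > 0`, `p > 0`, `e_k > 0` and every fixed `A`, the interpolated χ-factor
`χ(c·p(te_k), A)` equals 1 for all sufficiently small `t > 0`. [cite: BalabanImbrieJaffe1988, (5.14.2) p.308] -/
theorem eventually_cutoff_t_eq_one (χ : CutoffProfile) {c p ek : ℝ} (hc : 0 < c) (hp : 0 < p) (hek : 0 < ek) (A : ℝ) :
    ∀ᶠ t in 𝓝[>] (0 : ℝ), cutoff χ (c * pLog p (t * ek)) A = 1 := by
  set T : ℝ := Real.exp (-((|A| / (9 / 10 * c)) ^ p⁻¹)) / ek with hT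
  have hT0 : 0 < T := div_pos (Real.exp_pos _) hek
  filter_upwards [Ioc_mem_nhdsGT hT0] with t ht
  refine cutoff_t_eq_one_of_le χ hc hp hek ht.1 A ?_
  calc t * ek ≤ T * ek := mul_le_mul_of_nonneg_right ht.2 hek.le
    _ = Real.exp (-((|A| / (9 / 10 * c)) ^ p⁻¹)) := by rw [hT]; field_simp

/-- … hence `χ(c·p(te_k), A) → 1` as `t → 0⁺`. [cite: BalabanImbrieJaffe1988, (5.14.2) p.308] -/
theorem tendsto_cutoff_t_one (χ : CutoffProfile) {c p ek : ℝ} (hc : 0 < c) (hp : 0 < p) (hek : 0 < ek) (A : ℝ) :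
    Tendsto (fun t => cutoff χ (c * pLog p (t * ek)) A) (𝓝[>] (0 : ℝ)) (𝓝 1) :=
  tendsto_const_nhds.congr' ((eventually_cutoff_t_eq_one χ hc hp hek A).mono fun _ h => h.symm)

/-! ## The interactions disappear at t = 0 -/

/-- **p. 308, "the interactions disappear at t = 0"**: the interpolated Boltzmann factor `e^{−tṼ}` equals 1 at `t = 0`.
[cite: BalabanImbrieJaffe1988, (5.14.2) p.308] -/
theorem exp_interaction_zero (V : ℝ) : Real.exp (-((0 : ℝ) * V)) = 1 := by
  simp

/-- … and `e^{−tṼ} → 1` as `t → 0` (so at `t = 0` *"we have a purely Gaussian expectation"*). [cite: BalabanImbrieJaffe1988, (5.14.2) p.308] -/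
theorem tendsto_exp_interaction_one (V : ℝ) : Tendsto (fun t : ℝ => Real.exp (-(t * V))) (𝓝 0) (𝓝 1) := by
  have h : Continuous fun t : ℝ => Real.exp (-(t * V)) := (continuous_id.mul continuous_const).neg.rexp
  simpa using h.tendsto 0

end Literature.MathematicalPhysics.QuantumFieldTheory.BalabanImbrieJaffe1984to88.BIJ88RestrictionsVanish308
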